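import Mathlib

/-!
# Crux `MustSqueeze` (stmt-NavierStokesRegularity-11610), negative side: the quarter is Leray's exponent

Negative-side (cdisprove, D-0016) tightness lemmas extracted from `Cruxes/MustSqueeze/Disproof.lean`
v10 (§3b).  The crux's engine in backward similarity variables is `½Z' + ¼Z + ‖∇Ω‖² ≤ (sup Λ⁺)·Z`
with the threshold `¼`; its FORWARD, finite-enstrophy skeleton is the real-variable comparison below:
Miller's enstrophy law `½y' = ∫ω·Sω − ‖∇ω‖² ≤ λ₂⁺_max·y` under the forward gauge squeeze
`(T − t)λ₂⁺ ≤ a` reads `(T − t)y' ≤ 2a·y`, and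

* `forward_gauge_comparison` — then `y(t)(T − t)^{2a}` is non-increasing;
* `no_leray_rate_of_subquarter` — for `a < 1/4` this is incompatible with Leray's lower bound
  `c ≤ y(t)√(T − t)` (`c > 0`) at a blow-up time: "squeezed below ¼ ⇒ no blow-up" is three lines for
  finite-enstrophy solutions (the crux is the ANCIENT, LOCAL-ENERGY version of exactly this);
* `quarter_rate_saturates` — at `a = 1/4` the function `y = (T − t)^{−1/2}` satisfies the law with
  equality AND Leray's bound: the mechanism is void at the quarter (tightness of the threshold from
  the forward side; the pointwise side is `production_const_sharp` in the work file).

Pure real analysis over Mathlib; no statement of the route is changed (`--supports`).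
-/

noncomputable section

namespace Summit.NavierStokesRegularity.NavierStokesRegularity.Theorems.MustSqueeze.Negative

open Set Filter Topology

/-! ## The forward quarter law, real-variable form -/

/-- **Forward-gauge comparison.** If `y` (think `y(t) = ‖ω(t)‖²_{L²}` of a finite-enstrophy
solution on `[t₀, T)`) satisfies `(T − t)·y' ≤ 2a·y` — which is Miller's enstrophy law
`½y' = ∫ω·Sω − ‖∇ω‖² ≤ 2λ₂⁺_max ∫|S|² = λ₂⁺_max·y` under the FORWARD gauge squeeze
`(T − t)λ₂⁺ ≤ a` — then `y(t)(T − t)^{2a}` is non-increasing: `y(t) ≤ y(t₀)((T−t₀)/(T−t))^{2a}`. -/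
theorem forward_gauge_comparison {y : ℝ → ℝ} {a T t₀ : ℝ}
    (hy : ∀ t ∈ Set.Ico t₀ T, DifferentiableAt ℝ y t)
    (hineq : ∀ t ∈ Set.Ico t₀ T, deriv y t * (T - t) ≤ 2 * a * y t) :
    ∀ t ∈ Set.Ico t₀ T, y t * (T - t) ^ (2 * a) ≤ y t₀ * (T - t₀) ^ (2 * a) := by
  set g : ℝ → ℝ := fun t => y t * (T - t) ^ (2 * a) with hg
  have hgd : ∀ t ∈ Set.Ico t₀ T, HasDerivAt g
      (deriv y t * (T - t) ^ (2 * a) + y t * ((-1) * (2 * a) * (T - t) ^ (2 * a - 1))) t := by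
    intro t ht
    have hTt : 0 < T - t := by linarith [ht.2]
    have h1 : HasDerivAt (fun t => T - t) (-1) t := by
      simpa using (hasDerivAt_id t).const_sub T
    have h2 : HasDerivAt (fun t => (T - t) ^ (2 * a)) ((-1) * (2 * a) * (T - t) ^ (2 * a - 1)) t :=
      h1.rpow_const (Or.inl hTt.ne')
    exact ((hy t ht).hasDerivAt).mul h2
  have hanti : AntitoneOn g (Set.Ico t₀ T) := by
    refine antitoneOn_of_deriv_nonpos (convex_Ico t₀ T) ?_ ?_ ?_
    · exact fun t ht => (hgd t ht).continuousAt.continuousWithinAt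
    · rw [interior_Ico]
      exact fun t ht => (hgd t (Set.Ioo_subset_Ico_self ht)).differentiableAt.differentiableWithinAt
    · rw [interior_Ico]
      intro t ht
      have ht' : t ∈ Set.Ico t₀ T := Set.Ioo_subset_Ico_self ht
      rw [(hgd t ht').deriv]
      have hTt : 0 < T - t := by linarith [ht.2]
      have hpow : (T - t) ^ (2 * a) = (T - t) ^ (2 * a - 1) * (T - t) := by
        rw [← Real.rpow_add_one hTt.ne' (2 * a - 1)]; ring_nf
      have hp : 0 < (T - t) ^ (2 * a - 1) := Real.rpow_pos_of_pos hTt _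
      have key : deriv y t * (T - t) ^ (2 * a) + y t * ((-1) * (2 * a) * (T - t) ^ (2 * a - 1))
          = (T - t) ^ (2 * a - 1) * (deriv y t * (T - t) - 2 * a * y t) := by
        rw [hpow]; ring
      rw [key]
      exact mul_nonpos_of_nonneg_of_nonpos hp.le (by linarith [hineq t ht'])
  intro t ht
  have ht₀ : t₀ ∈ Set.Ico t₀ T := ⟨le_rfl, lt_of_le_of_lt ht.1 ht.2⟩
  exact hanti ht₀ ht ht.1

/-- **No Leray rate below the quarter.** With `a < 1/4` the comparison gives
`y(t) = O((T−t)^{−2a}) = o((T−t)^{−1/2})`, incompatible with Leray's lower bound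
`‖∇u(t)‖²_{L²} ≥ c²(T − t)^{−1/2}` at a blow-up time (`c ≤ y√(T−t)`): in the forward,
finite-enstrophy setting "squeezed below ¼ in the gauge ⇒ no blow-up at `T`" is three lines
(Miller 2019/2020 enstrophy identity + Leray 1934 rate).  The crux is the ANCIENT, LOCAL-ENERGY
version of exactly this, with the similarity enstrophy a priori infinite. -/
theorem no_leray_rate_of_subquarter {y : ℝ → ℝ} {a c T t₀ : ℝ} (ha : a < 1 / 4) (hc : 0 < c)
    (ht₀ : t₀ < T)
    (hy : ∀ t ∈ Set.Ico t₀ T, DifferentiableAt ℝ y t)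
    (hineq : ∀ t ∈ Set.Ico t₀ T, deriv y t * (T - t) ≤ 2 * a * y t)
    (hleray : ∀ t ∈ Set.Ico t₀ T, c ≤ y t * Real.sqrt (T - t)) : False := by
  have hcomp := forward_gauge_comparison hy hineq
  set M : ℝ := y t₀ * (T - t₀) ^ (2 * a) with hM
  set e : ℝ := 1 / 2 - 2 * a with he
  have he0 : 0 < e := by rw [he]; linarith
  -- along `[t₀, T)`: `c ≤ M (T - t)^e`
  have hbound : ∀ t ∈ Set.Ico t₀ T, c ≤ M * (T - t) ^ e := by
    intro t ht
    have hTt : 0 < T - t := by linarith [ht.2]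
    have h1 : y t * (T - t) ^ (2 * a) ≤ M := hcomp t ht
    have h2 : c ≤ y t * Real.sqrt (T - t) := hleray t ht
    have hsqrt : Real.sqrt (T - t) = (T - t) ^ (2 * a) * (T - t) ^ e := by
      rw [Real.sqrt_eq_rpow, ← Real.rpow_add hTt]; congr 1; rw [he]; ring
    have hpe : 0 < (T - t) ^ e := Real.rpow_pos_of_pos hTt _
    calc c ≤ y t * Real.sqrt (T - t) := h2
      _ = (y t * (T - t) ^ (2 * a)) * (T - t) ^ e := by rw [hsqrt]; ring
      _ ≤ M * (T - t) ^ e := mul_le_mul_of_nonneg_right h1 hpe.le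
  -- `M > 0`
  have hM0 : 0 < M := by
    have h := hbound t₀ ⟨le_rfl, ht₀⟩
    have hpe : 0 < (T - t₀) ^ e := Real.rpow_pos_of_pos (by linarith) _
    by_contra hcon
    have : M * (T - t₀) ^ e ≤ 0 := mul_nonpos_of_nonpos_of_nonneg (not_lt.1 hcon) hpe.le
    linarith
  -- choose `t` close to `T` with `M (T - t)^e < c`
  set d : ℝ := min (T - t₀) ((c / M) ^ (1 / e)) with hd
  have hcM : 0 < c / M := div_pos hc hM0
  have hd0 : 0 < d := lt_min (by linarith) (Real.rpow_pos_of_pos hcM _)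
  set t : ℝ := T - d / 2 with ht
  have ht1 : t ∈ Set.Ico t₀ T := by
    refine ⟨?_, by rw [ht]; linarith⟩
    have : d ≤ T - t₀ := min_le_left _ _
    rw [ht]; linarith
  have hTt : T - t = d / 2 := by rw [ht]; ring
  have hlt : (T - t) ^ e < c / M := by
    rw [hTt]
    have h1 : d / 2 < (c / M) ^ (1 / e) := by
      have : d ≤ (c / M) ^ (1 / e) := min_le_right _ _
      linarith
    have h2 : (d / 2) ^ e < ((c / M) ^ (1 / e)) ^ e :=
      Real.rpow_lt_rpow (by linarith) h1 he0
    rwa [← Real.rpow_mul hcM.le, one_div_mul_cancel he0.ne', Real.rpow_one] at h2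
  have h3 : M * (T - t) ^ e < c := by
    calc M * (T - t) ^ e < M * (c / M) := mul_lt_mul_of_pos_left hlt hM0
      _ = c := by field_simp
  linarith [hbound t ht1]

/-- **At the quarter the rate saturates.** `y(t) = (T − t)^{−1/2}` satisfies the forward-gauge
law with EQUALITY at `a = 1/4` and Leray's lower bound with `c = 1` for every `t < T`: the ODE
mechanism cannot exclude blow-up at `a = 1/4` (tightness of the threshold from the forward side;
cf. `production_const_sharp` for the pointwise side). -/
theorem quarter_rate_saturates (T : ℝ) :
    ∃ y : ℝ → ℝ, ∀ t < T, DifferentiableAt ℝ y t ∧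
      deriv y t * (T - t) = 2 * (1 / 4) * y t ∧ 1 ≤ y t * Real.sqrt (T - t) := by
  refine ⟨fun t => (T - t) ^ (-(1 / 2 : ℝ)), fun t ht => ?_⟩
  have hTt : 0 < T - t := by linarith
  have h1 : HasDerivAt (fun t => T - t) (-1) t := by
    simpa using (hasDerivAt_id t).const_sub T
  have h2 : HasDerivAt (fun t => (T - t) ^ (-(1 / 2 : ℝ)))
      ((-1) * (-(1 / 2 : ℝ)) * (T - t) ^ (-(1 / 2 : ℝ) - 1)) t :=
    h1.rpow_const (Or.inl hTt.ne')
  refine ⟨h2.differentiableAt, ?_, ?_⟩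
  · rw [h2.deriv]
    have : (T - t) ^ (-(1 / 2 : ℝ) - 1) * (T - t) = (T - t) ^ (-(1 / 2 : ℝ)) := by
      rw [← Real.rpow_add_one hTt.ne']; ring_nf
    calc -1 * -(1 / 2 : ℝ) * (T - t) ^ (-(1 / 2 : ℝ) - 1) * (T - t)
        = (1 / 2) * ((T - t) ^ (-(1 / 2 : ℝ) - 1) * (T - t)) := by ring
      _ = 2 * (1 / 4) * (T - t) ^ (-(1 / 2 : ℝ)) := by rw [this]; ring
  · rw [Real.sqrt_eq_rpow, ← Real.rpow_add hTt]
    norm_num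


end Summit.NavierStokesRegularity.NavierStokesRegularity.Theorems.MustSqueeze.Negative

end
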